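import Mathlib
import HarnessLib
import Summits.HubbardSuperconductivity.HubbardSuperconductivity.Theorems.KLProgrammeKLRegimeTwoVolumeTowerEpsRegime

/-!
# Route `KLProgramme` — crux K3, VL child `KLRegimeVolumeLimitV17F2` (stmt-HubbardSuperconductivity-20440), skeleton «cauchy» v11: THE FOUR `ε`-INEQUALITIES OF
# THE ASSEMBLER FROM ONE PAIR OF DOORS `(c₅, U₀)` (seat hubbard-kl-k3c4-p1 g15; `--supports` 20440)

`…TowerDataTSExists.exists_towerDataTS_of_readouts` asks, for `j ≤ n_β`: `0 < ε_{j+1}`, `ε_{j+1} ≤ εb`, `8·CE·D_q·ε_{j+1} ≤ 1`, `8·CE′·D_q·ε_{j+1} ≤ 1` and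
(`j < n_β`) `ε_{j+1}·W ≤ k₀²`.  With `εb := 1` all are of the shape `ε_{j+1}·B ≤ 1` (`B = 1, 8·CE·D_q, 8·CE′·D_q, W/k₀²`), so ONE pair of doors — the minimum
of the four pairs of `…TowerEpsRegime.exists_doors_epsCoupling_succ_mul_le_one` — delivers them for every `0 < |U| ≤ U₀`, `0 ≤ c ≤ c₅`, `klBetaMin ≤ β ≤ exp(c/U²)`
(`Klam > 0` for the positivity): **`exists_doors_towerEps`**.  This is the `∃ c₅ … ∃ U₀ …` of `stub_vl_towerData`.

Proofs only; no definition; elementary. [cite: BenfattoGiulianiMastropietro2006, §2.7 (2.77)-(2.80)]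
-/

noncomputable section

namespace Summit.HubbardSuperconductivity.HubbardSuperconductivity.Theorems.TwoVolumeSource

set_option linter.dupNamespace false -- summit = problem name (single-conjunct summit), D-0017

open Summit.HubbardSuperconductivity.HubbardSuperconductivity.Theorems.KLProgrammeLegKernels
open Summit.HubbardSuperconductivity.HubbardSuperconductivity.Theorems.KLRegimeSplit
open Summit.HubbardSuperconductivity.HubbardSuperconductivity.Theorems.EngineV8

/-- **ONE PAIR OF DOORS FOR THE FOUR `ε`-INEQUALITIES** (see the module docstring). [cite: BenfattoGiulianiMastropietro2006, §2.7 (2.77)-(2.80)] -/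
theorem exists_doors_towerEps {P : SplitConsts} (hK : 0 < P.Klam) {B₂ B₃ W k₀ : ℝ} (hB₂ : 0 ≤ B₂) (hB₃ : 0 ≤ B₃) (hW : 0 ≤ W) (hk₀ : 0 < k₀) :
    ∃ c₅ : ℝ, 0 < c₅ ∧ ∃ U₀ : ℝ, 0 < U₀ ∧ ∀ c, 0 ≤ c → c ≤ c₅ → ∀ U : ℝ, U ≠ 0 → |U| ≤ U₀ → ∀ β, klBetaMin ≤ β → β ≤ Real.exp (c / U ^ 2) →
      ∀ j, j ≤ nScales β → 0 < epsCoupling P U (j + 1) ∧ epsCoupling P U (j + 1) ≤ 1 ∧ B₂ * epsCoupling P U (j + 1) ≤ 1 ∧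
        B₃ * epsCoupling P U (j + 1) ≤ 1 ∧ epsCoupling P U (j + 1) * W ≤ k₀ ^ 2 := by
  have hk2 : 0 < k₀ ^ 2 := by positivity
  obtain ⟨c₁, hc₁, U₁, hU₁, h₁⟩ := exists_doors_epsCoupling_succ_mul_le_one hK.le (B := 1) zero_le_one
  obtain ⟨c₂, hc₂, U₂, hU₂, h₂⟩ := exists_doors_epsCoupling_succ_mul_le_one hK.le hB₂
  obtain ⟨c₃, hc₃, U₃, hU₃, h₃⟩ := exists_doors_epsCoupling_succ_mul_le_one hK.le hB₃
  obtain ⟨c₄, hc₄, U₄, hU₄, h₄⟩ := exists_doors_epsCoupling_succ_mul_le_one hK.le (B := W / k₀ ^ 2) (div_nonneg hW hk2.le)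
  refine ⟨min (min c₁ c₂) (min c₃ c₄), by positivity, min (min U₁ U₂) (min U₃ U₄), by positivity, ?_⟩
  intro c hc0 hc U hU0 hU β hβ hβc j hj
  have hc1 : c ≤ c₁ := hc.trans ((min_le_left _ _).trans (min_le_left _ _))
  have hc2 : c ≤ c₂ := hc.trans ((min_le_left _ _).trans (min_le_right _ _))
  have hc3 : c ≤ c₃ := hc.trans ((min_le_right _ _).trans (min_le_left _ _))
  have hc4 : c ≤ c₄ := hc.trans ((min_le_right _ _).trans (min_le_right _ _))
  have hu1 : |U| ≤ U₁ := hU.trans ((min_le_left _ _).trans (min_le_left _ _))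
  have hu2 : |U| ≤ U₂ := hU.trans ((min_le_left _ _).trans (min_le_right _ _))
  have hu3 : |U| ≤ U₃ := hU.trans ((min_le_right _ _).trans (min_le_left _ _))
  have hu4 : |U| ≤ U₄ := hU.trans ((min_le_right _ _).trans (min_le_right _ _))
  have e1 := h₁ c hc0 hc1 U hu1 β hβ hβc j hj
  have e2 := h₂ c hc0 hc2 U hu2 β hβ hβc j hj
  have e3 := h₃ c hc0 hc3 U hu3 β hβ hβc j hj
  have e4 := h₄ c hc0 hc4 U hu4 β hβ hβc j hj
  refine ⟨epsCoupling_pos_of_ne hK hU0 _, by simpa using e1, by rw [mul_comm]; exact e2, by rw [mul_comm]; exact e3, ?_⟩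
  rw [← mul_div_assoc, div_le_one hk2] at e4
  exact e4

end Summit.HubbardSuperconductivity.HubbardSuperconductivity.Theorems.TwoVolumeSource

end
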